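import Literature.AlgebraicTopology.SingularHomology.WeakEquivalenceHomology
import Literature.AlgebraicTopology.Homotopy.StdSimplexCW
import Literature.AlgebraicTopology.Homotopy.CellularSkelPush
import Literature.AlgebraicTopology.SingularHomology.LocalHomology
import Literature.AlgebraicTopology.SingularHomology.HurewiczCompression
import HarnessLib

/-!
# Cellular singular chains of a filtered space: Spanier 9.2 Lemma 3

Topic `Literature/AlgebraicTopology/SingularHomology`. E. H. Spanier, *Algebraic Topology*
(1981), Ch. 9, Sec. 2, Lemma 3 (p. 468 of the held copy): for a space `X` with subspaces
`X_k` such that every map `(Δ^q × 0 ∪ Δ̇^q × I, Δ̇^q × 1) → (X, X_q)` extends over `Δ^q × I`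
with `Δ^q × 1 → X_q` — e.g. the skeleta of a CW complex (Spanier's relative CW complexes, via
Ch. 7 Sec. 6 Cor. 18) — a singular simplex `σ : Δ^q → X` is CELLULAR if `σ((Δ^q)ᵏ) ⊆ X_k` for all
`k`, and **the subcomplex `Δ̄(X)` of `Δ(X)` generated by the cellular singular simplices is a
chain deformation retract of `Δ(X)`** ("using the method of proof of theorem 7.4.7"); moreover
for a subspace `X'` with `X'_k = X' ∩ X_k`, `Δ̄(X') = Δ̄(X) ∩ Δ(X')` and the deformation
retraction of `Δ(X)` induces one of `Δ(X')`. This file PROVES the homological content: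

* `CellularChains.IsCellular Xf ρ` (the open `d`-faces of `Δ^q` go to `Xf d`; stable under faces),
  `cellChains`, **`cellSub Xf R : Subcomplex (csingularChainComplex R R X)`** — `Δ̄(X)`;
* `CellularChains.FStage` / `exists_stage_zero` / `exists_stage_succ` / `exists_tower` — the
  Eilenberg–Spanier deformation run with the FILTERED target condition (the end simplex is
  cellular; cellular simplices are not moved; a simplex of `Xf j` is deformed inside `Xf j`),
  from a compression `Oracle` in each dimension (fill the prism by the tree's
  `RelativeCompression.exists_fill_stationary` inside the least `Xf j ∋ σ`, then compress the lid
  rel boundary); the chain-level pipeline (`prismOp`, `∂D + D∂ = τ - 𝟙`) is the tree's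
  `StagedDeformation.*` (`WeakEquivalenceHomology.lean`) fed with the stages viewed as
  `StageData univ`;
* `tauOp` (`ρ ↦ ρ̄`, a chain map landing in `Δ̄(X)`, the identity on `Δ̄(X)`), and
  **`isIso_homologyMap_cellSub_ι`**: `Δ̄(X) ↪ Δ(X)` induces isomorphisms on all homology groups;
  **`isIso_homologyMap_cellSubIn_ι`**: so does `Δ̄(X) ∩ Δ(Xf j) ↪ Δ(Xf j)` for every `j`;
* for a Hausdorff classical CW complex `Y` with `skel Y k = skeletonLT (k+1)`:
  `covers_skel`, **`oracle_skel`** (cellular approximation: the tree's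
  `exists_homotopy_clear_dim`, iterated keeping its range clause, transported along `Δⁿ ≅ 𝔻ⁿ`),
  **`isIso_homologyMap_cellSub_skel_ι`**, **`isIso_homologyMap_cellSubIn_skel_ι`**.

No named facts. Brick (γ2a) of the printed proof of
`Literature.AlgebraicTopology.Homotopy.Spanier1981_eulerChar_fibreBundle` (Spanier 9.3 Thm. 1 via
9.2 Thms. 13–16: the chain map `ψ : Δ̄(Bˢ, Bˢ⁻¹) ⊗ Hₙ(F) → E¹` and Thm. 15 (a)).

## References

* E. H. Spanier, *Algebraic Topology*, Springer (1981), Ch. 9, Sec. 2, Lemma 3; Ch. 7, Sec. 4,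
  Lemma 7, Thm. 8. [Spanier1981]
* A. Hatcher, *Algebraic Topology*, CUP (2002), Thm. 4.8 (cellular approximation), Prop. A.1.
  [HatcherAT2002]
-/

noncomputable section

set_option backward.isDefEq.respectTransparency false

open Set Function CategoryTheory Limits Topology
open scoped unitInterval
open Literature.AlgebraicTopology.Homotopy
open Literature.AlgebraicTopology.Homotopy.WhiteheadCW (tau tau_pos tau_lt_one tau_le_one tau_lt_succ)

universe u uR

namespace Literature.AlgebraicTopology.SingularHomology

namespace CellularChains

open SingularSimplex RelativeDeformation StdSimplexCW

variable {X : Type u} [TopologicalSpace X] (Xf : ℕ → Set X)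

/-! ### Cellular singular simplices -/

/-- The dimension of the open face of `Δᵏ` containing `z` (`= |support z| - 1`). [folklore] -/
def dimPt {k : ℕ} (z : StdSimplex k) : ℕ := (StdSimplexCW.support z).card - 1

omit [TopologicalSpace X] in
/-- The carrying face has dimension at most `k`. [folklore] -/
theorem dimPt_le {k : ℕ} (z : StdSimplex k) : dimPt z ≤ k := by
  have : (StdSimplexCW.support z).card ≤ k + 1 := (Finset.card_le_univ _).trans_eq (by simp)
  unfold dimPt; omega

omit [TopologicalSpace X] in
/-- Cofaces preserve the dimension of the carrying open face. [folklore] -/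
theorem dimPt_stdFace {k : ℕ} (i : Fin (k + 2)) (z : StdSimplex k) : dimPt (stdFace i z) = dimPt z := by
  unfold dimPt
  have : StdSimplexCW.support (stdFace i z) = (StdSimplexCW.support z).map (Fin.succAboveEmb i) := by
    ext l
    simp only [StdSimplexCW.mem_support_iff, Finset.mem_map, Fin.succAboveEmb_apply]
    constructor
    · intro h
      by_cases hl : l = i
      · subst hl; exact absurd (stdFace_apply_self l z) h
      · obtain ⟨l', rfl⟩ := Fin.exists_succAbove_eq hl
        exact ⟨l', by rwa [stdFace_apply_succAbove] at h, rfl⟩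
    · rintro ⟨l', h, rfl⟩
      rwa [stdFace_apply_succAbove]
  rw [this, Finset.card_map]

/-- A singular simplex is **cellular** for the filtration `Xf` when it maps every open `d`-face of
`Δᵏ` into `Xf d` (Spanier: "`σ((Δ^q)ᵏ) ⊆ X_k` for all `k`"). [cite: Spanier1981, Ch. 9 Sec. 2 (before Lemma 3)] -/
def IsCellular {k : ℕ} (ρ : SingularSimplex X k) : Prop := ∀ z : StdSimplex k, toContinuousMap ρ z ∈ Xf (dimPt z)

variable {Xf}

/-- Faces of cellular simplices are cellular. [folklore] -/
theorem IsCellular.face {k : ℕ} {η : SingularSimplex X (k + 1)} (h : IsCellular Xf η) (i : Fin (k + 2)) :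
    IsCellular Xf (η.face i) := fun z => by
  rw [toContinuousMap_face_apply, ← dimPt_stdFace i z]
  exact h _

/-! ### The stages of the deformation -/

variable (Xf)

/-- Stage `k` of the deformation of singular simplices into cellular ones: homotopies `P ρ` of the
singular `k`-simplices, starting at `ρ`, stationary from time `τ_k` on, ending at a CELLULAR
simplex, constant on cellular simplices, with compatible faces (Spanier 1981, proof of 9.2 Lemma 3
through Ch. 7 Sec. 4 Lemma 7 / Thm. 8). [cite: Spanier1981, Ch. 9 Sec. 2 Lemma 3] -/
structure FStage (k : ℕ) where
  /-- the homotopy of each singular `k`-simplex -/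
  P : SingularSimplex X k → C(StdSimplex k × I, X)
  /-- it starts at the simplex -/
  bot : ∀ (ρ : SingularSimplex X k) (z : StdSimplex k), P ρ (z, 0) = toContinuousMap ρ z
  /-- it is stationary from time `τ_k` on -/
  stat : ∀ (ρ : SingularSimplex X k) (z : StdSimplex k) (s : I), tau k ≤ (s : ℝ) → P ρ (z, s) = P ρ (z, 1)
  /-- it ends at a cellular simplex -/
  endCell : ∀ (ρ : SingularSimplex X k) (z : StdSimplex k), P ρ (z, 1) ∈ Xf (dimPt z)
  /-- a cellular simplex is not moved -/
  cell : ∀ ρ : SingularSimplex X k, IsCellular Xf ρ → ∀ (z : StdSimplex k) (s : I), P ρ (z, s) = toContinuousMap ρ z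
  /-- a simplex of `Xf j` is deformed inside `Xf j` -/
  fp : ∀ (ρ : SingularSimplex X k) (j : ℕ), ρ.range ⊆ Xf j → ∀ (z : StdSimplex k) (s : I), P ρ (z, s) ∈ Xf j
  /-- the homotopies of the faces of a `(k+1)`-simplex agree on the codimension-two faces -/
  compat : ∀ η : SingularSimplex X (k + 1), SimplexPrism.Compatible fun i => P (η.face i)

/-- **The compression oracle** of the filtration in dimension `n`: a singular simplex whose
boundary lies in `Xf n` deforms rel boundary into `Xf n` (for the skeleta of a CW complex:
cellular approximation, `oracle_of_cwComplex`). [folklore] -/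
def Oracle (n : ℕ) : Prop :=
  ∀ (g : C(StdSimplex n, X)) (j : ℕ), (∀ t, g t ∈ Xf j) → (∀ t ∈ stdBoundary n, g t ∈ Xf n) →
    ∃ K : C(StdSimplex n × I, X), (∀ t, K (t, 0) = g t) ∧ (∀ t, K (t, 1) ∈ Xf n) ∧
      (∀ t ∈ stdBoundary n, ∀ s, K (t, s) = g t) ∧ (∀ t s, K (t, s) ∈ Xf j)

/-- Every singular simplex lies in some term of the filtration (for CW complexes: a compact set lies
in a finite skeleton). [folklore] -/
def Covers (Xf' : ℕ → Set X) : Prop := ∀ (k : ℕ) (ρ : SingularSimplex X k), ∃ j, ρ.range ⊆ Xf' j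

variable {Xf}

/-- Reparametrise a homotopy to be stationary from time `τ` on. [folklore] -/
theorem exists_stationary_of {n : ℕ} {g : C(StdSimplex n, X)} {S V : Set X} (K : C(StdSimplex n × I, X))
    (hK0 : ∀ t, K (t, 0) = g t) (hK1 : ∀ t, K (t, 1) ∈ S) (hKb : ∀ t ∈ stdBoundary n, ∀ s, K (t, s) = g t)
    (hKV : ∀ t s, K (t, s) ∈ V) {τ : ℝ} (hτ0 : 0 < τ) (hτ1 : τ ≤ 1) :
    ∃ K' : C(StdSimplex n × I, X), (∀ t, K' (t, 0) = g t) ∧ (∀ t, K' (t, 1) ∈ S) ∧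
      (∀ t ∈ stdBoundary n, ∀ s, K' (t, s) = g t) ∧ (∀ t (s : I), τ ≤ (s : ℝ) → K' (t, s) = K' (t, 1)) ∧
      (∀ t s, K' (t, s) ∈ V) := by
  refine ⟨K.comp ⟨fun p => (p.1, Set.projIcc 0 1 zero_le_one ((p.2 : ℝ) / τ)),
    continuous_fst.prodMk (continuous_projIcc.comp ((continuous_subtype_val.comp continuous_snd).div_const τ))⟩,
    fun t => ?_, fun t => ?_, fun t ht s => hKb t ht _, fun t s hs => ?_, fun t s => hKV _ _⟩
  · show K (t, projIcc 0 1 zero_le_one (((0 : I) : ℝ) / τ)) = g t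
    rw [show ((0 : I) : ℝ) / τ = 0 by simp, Set.projIcc_left]; exact hK0 t
  · show K (t, projIcc 0 1 zero_le_one (((1 : I) : ℝ) / τ)) ∈ S
    rw [Set.projIcc_of_right_le _ (by rw [Set.Icc.coe_one, le_div_iff₀ hτ0, one_mul]; exact hτ1)]
    exact hK1 t
  · show K (t, projIcc 0 1 zero_le_one ((s : ℝ) / τ)) = K (t, projIcc 0 1 zero_le_one (((1 : I) : ℝ) / τ))
    rw [Set.projIcc_of_right_le _ (by rw [le_div_iff₀ hτ0, one_mul]; exact hs),
      Set.projIcc_of_right_le _ (by rw [Set.Icc.coe_one, le_div_iff₀ hτ0, one_mul]; exact hτ1)]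

/-- The least term of the filtration containing a simplex. [folklore] -/
def minIdx (hcov : Covers Xf) {k : ℕ} (ρ : SingularSimplex X k) : ℕ := by
  classical exact Nat.find (hcov k ρ)

/-- The simplex lies in its least term. [folklore] -/
theorem range_subset_minIdx (hcov : Covers Xf) {k : ℕ} (ρ : SingularSimplex X k) : ρ.range ⊆ Xf (minIdx hcov ρ) := by
  classical exact Nat.find_spec (hcov k ρ)

/-- Minimality of the least term. [folklore] -/
theorem minIdx_le (hcov : Covers Xf) {k : ℕ} (ρ : SingularSimplex X k) {j : ℕ} (hj : ρ.range ⊆ Xf j) :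
    minIdx hcov ρ ≤ j := by
  classical exact Nat.find_min' (hcov k ρ) hj

omit [TopologicalSpace X] in
/-- Values of a singular simplex lie in its range. [folklore] -/
theorem mem_range (k : ℕ) [TopologicalSpace X] (ρ : SingularSimplex X k) (z : StdSimplex k) :
    toContinuousMap ρ z ∈ ρ.range := ⟨z, rfl⟩

/-- **Stage `0`** from the oracle in dimension `0` (every point is joined to `Xf 0`). [folklore] -/
theorem exists_stage_zero (hmono : Monotone Xf) (hcov : Covers Xf) (h0 : Oracle Xf 0) : Nonempty (FStage Xf 0) := by
  classical
  have key : ∀ ρ : SingularSimplex X 0, ∃ G : C(StdSimplex 0 × I, X),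
      (∀ z, G (z, 0) = toContinuousMap ρ z) ∧ (∀ z (s : I), tau 0 ≤ (s : ℝ) → G (z, s) = G (z, 1)) ∧
      (∀ z, G (z, 1) ∈ Xf 0) ∧ (IsCellular Xf ρ → ∀ z s, G (z, s) = toContinuousMap ρ z) ∧
      (∀ j, ρ.range ⊆ Xf j → ∀ z s, G (z, s) ∈ Xf j) := by
    intro ρ
    by_cases hρ : IsCellular Xf ρ
    · refine ⟨⟨fun p => toContinuousMap ρ p.1, (toContinuousMap ρ).continuous.comp continuous_fst⟩,
        fun z => rfl, fun z s _ => rfl, fun z => ?_, fun _ z s => rfl, fun j hj z s => hj (mem_range 0 ρ z)⟩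
      have := hρ z
      rwa [show dimPt z = 0 from by have := dimPt_le z; omega] at this
    · obtain ⟨K, hK0, hK1, -, hKV⟩ := h0 (toContinuousMap ρ) (minIdx hcov ρ)
        (fun t => range_subset_minIdx hcov ρ (mem_range 0 ρ t)) (fun t ht => by simp [stdBoundary_zero] at ht)
      obtain ⟨K', hK'0, hK'1, -, hK'st, hK'V⟩ := exists_stationary_of (S := Xf 0) K hK0 hK1
        (fun t ht => by simp [stdBoundary_zero] at ht) hKV (tau_pos 0) (tau_le_one 0)
      exact ⟨K', hK'0, hK'st, hK'1, fun h => absurd h hρ, fun j hj z s => hmono (minIdx_le hcov ρ hj) (hK'V z s)⟩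
  choose G hG0 hGst hG1 hGc hGfp using key
  refine ⟨{ P := G, bot := hG0, stat := hGst, endCell := fun ρ z => ?_, cell := hGc, fp := hGfp, compat := fun η => ?_ }⟩
  · rw [show dimPt z = 0 from by have := dimPt_le z; omega]; exact hG1 ρ z
  · intro i j t t' s h
    -- `Δ⁰` has one point: the two faces of a `1`-simplex meet only if `i = j`
    have hij : i = j := by
      by_contra hij
      have h1 := congrArg (fun y : StdSimplex 1 => (y : Fin 2 → ℝ) i) h
      simp only [stdFace_apply_self] at h1
      obtain ⟨l, hl⟩ := Fin.exists_succAbove_eq hij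
      rw [← hl, stdFace_apply_succAbove] at h1
      have := sum_coord t'
      rw [Fin.sum_univ_one, Subsingleton.elim (0 : Fin 1) l] at this
      rw [this] at h1
      exact one_ne_zero h1.symm
    subst hij
    rw [Subsingleton.elim t t']

/-- **The inductive step**: from stage `k` and the oracle in dimension `k + 1`, a stage `k + 1`
whose homotopies restrict on the faces to those of stage `k`. [cite: Spanier1981, Ch. 9 Sec. 2 Lemma 3 (proof)] -/
theorem exists_stage_succ {k : ℕ} (S : FStage Xf k) (hmono : Monotone Xf) (hcov : Covers Xf) (hor : Oracle Xf (k + 1)) :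
    ∃ S' : FStage Xf (k + 1), ∀ (η : SingularSimplex X (k + 1)) (i : Fin (k + 2))
      (t : StdSimplex k) (s : I), S'.P η (stdFace i t, s) = S.P (η.face i) (t, s) := by
  classical
  have key : ∀ η : SingularSimplex X (k + 1), ∃ G : C(StdSimplex (k + 1) × I, X),
      (∀ z, G (z, 0) = toContinuousMap η z) ∧
      (∀ i t s, G (stdFace i t, s) = S.P (η.face i) (t, s)) ∧
      (∀ z (s : I), tau (k + 1) ≤ (s : ℝ) → G (z, s) = G (z, 1)) ∧
      (∀ z, G (z, 1) ∈ Xf (dimPt z)) ∧ (IsCellular Xf η → ∀ z s, G (z, s) = toContinuousMap η z) ∧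
      (∀ j, η.range ⊆ Xf j → ∀ z s, G (z, s) ∈ Xf j) := by
    intro η
    have hbot : ∀ i t, S.P (η.face i) (t, 0) = toContinuousMap η (stdFace i t) := fun i t => by
      rw [S.bot, toContinuousMap_face_apply]
    -- the lid, once filled, is cellular on the boundary
    have hbdry : ∀ (G : C(StdSimplex (k + 1) × I, X)), (∀ i t s, G (stdFace i t, s) = S.P (η.face i) (t, s)) →
        ∀ z ∈ stdBoundary (k + 1), G (z, 1) ∈ Xf (dimPt z) := fun G hGs z hz => by
      obtain ⟨i, hi⟩ := hz
      obtain ⟨t, rfl⟩ := exists_stdFace_eq i z hi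
      rw [hGs, dimPt_stdFace]
      exact S.endCell _ t
    by_cases hη : IsCellular Xf η
    · -- a cellular simplex: the constant homotopy
      refine ⟨⟨fun p => toContinuousMap η p.1, (toContinuousMap η).continuous.comp continuous_fst⟩,
        fun z => rfl, fun i t s => ?_, fun z s _ => rfl, fun z => hη z, fun _ z s => rfl,
        fun j hj z s => hj (mem_range (k + 1) η z)⟩
      show toContinuousMap η (stdFace i t) = S.P (η.face i) (t, s)
      rw [S.cell _ (hη.face i), toContinuousMap_face_apply]
    · -- fill the prism inside the least `Xf j₀ ∋ η`, then compress the lid rel boundary into `Xf (k+1)`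
      set j₀ := minIdx hcov η with hj₀
      have hηj₀ : η.range ⊆ Xf j₀ := range_subset_minIdx hcov η
      have hmem : ∀ z, toContinuousMap η z ∈ Xf j₀ := fun z => hηj₀ (mem_range (k + 1) η z)
      have hfaceA : ∀ i, (η.face i).range ⊆ Xf j₀ := fun i => (range_face_subset i η).trans hηj₀
      have hmemF : ∀ i (p : StdSimplex k × I), S.P (η.face i) p ∈ Xf j₀ := fun i p => by
        rcases p with ⟨z, s⟩; exact S.fp _ j₀ (hfaceA i) z s
      let f : C(StdSimplex (k + 1), ↥(Xf j₀)) :=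
        ⟨fun z => ⟨toContinuousMap η z, hmem z⟩, (toContinuousMap η).continuous.subtype_mk hmem⟩
      let F : Fin (k + 2) → C(StdSimplex k × I, ↥(Xf j₀)) := fun i =>
        ⟨fun p => ⟨S.P (η.face i) p, hmemF i p⟩, (S.P (η.face i)).continuous.subtype_mk (hmemF i)⟩
      have hF : SimplexPrism.Compatible F := fun i j t t' s h => Subtype.ext (S.compat η i j t t' s h)
      have hbotF : ∀ i t, F i (t, 0) = f (stdFace i t) := fun i t => Subtype.ext (hbot i t)
      have hstatF : ∀ i t (s : I), tau k ≤ (s : ℝ) → F i (t, s) = F i (t, 1) :=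
        fun i t s hs => Subtype.ext (S.stat _ t s hs)
      obtain ⟨G₀', hG₀'0, hG₀'s, hG₀'st⟩ :=
        RelativeCompression.exists_fill_stationary f F hF hbotF (tau_pos k) (tau_le_one k) hstatF
      let G₀ : C(StdSimplex (k + 1) × I, X) := ⟨fun p => (G₀' p : X), continuous_subtype_val.comp G₀'.continuous⟩
      have hG₀0 : ∀ z, G₀ (z, 0) = toContinuousMap η z := fun z => congrArg Subtype.val (hG₀'0 z)
      have hG₀s : ∀ i t s, G₀ (stdFace i t, s) = S.P (η.face i) (t, s) := fun i t s => congrArg Subtype.val (hG₀'s i t s)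
      have hG₀st : ∀ z (s : I), tau k ≤ (s : ℝ) → G₀ (z, s) = G₀ (z, 1) := fun z s hs => congrArg Subtype.val (hG₀'st z s hs)
      have hG₀V : ∀ z s, G₀ (z, s) ∈ Xf j₀ := fun z s => (G₀' (z, s)).2
      let g : C(StdSimplex (k + 1), X) := G₀.comp ⟨fun t => (t, 1), continuous_id.prodMk continuous_const⟩
      have hgapp : ∀ t, g t = G₀ (t, 1) := fun _ => rfl
      have hg : ∀ t ∈ stdBoundary (k + 1), g t ∈ Xf (k + 1) := fun t ht =>
        hmono (dimPt_le t) (hbdry G₀ hG₀s t ht)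
      obtain ⟨K₁, hK₁0, hK₁1, hK₁b, hK₁V⟩ := hor g j₀ (fun t => hG₀V t 1) hg
      obtain ⟨K, hK0, hK1, hKb, -, hKV⟩ :=
        exists_stationary_of (S := Xf (k + 1)) K₁ hK₁0 hK₁1 hK₁b hK₁V one_pos le_rfl
      -- assemble: `G₀` on `[0, τ]`, `K` on `[τ, (1+τ)/2]`, constant afterwards (as `exists_fill_into`)
      set τ : ℝ := tau k with hτdef
      have hτ0 : 0 < τ := tau_pos k
      have hτ1 : τ < 1 := tau_lt_one k
      set τ' : ℝ := (1 + τ) / 2 with hτ'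
      have hττ' : 0 < τ' - τ := by rw [hτ']; linarith
      let Gfun : StdSimplex (k + 1) × I → X := fun p =>
        if (p.2 : ℝ) ≤ τ then G₀ p else K (p.1, RelativeCompression.affTime τ (τ' - τ) p.2)
      have hGc : Continuous Gfun := by
        refine Continuous.if_le G₀.continuous ?_ (continuous_subtype_val.comp continuous_snd) continuous_const ?_
        · exact K.continuous.comp (continuous_fst.prodMk
            ((RelativeCompression.continuous_affTime τ (τ' - τ)).comp continuous_snd))
        · rintro ⟨t, s⟩ hs
          simp only at hs
          rw [RelativeCompression.affTime_self τ (τ' - τ) s hs, hK0, hgapp, hG₀st t s hs.ge]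
      let G : C(StdSimplex (k + 1) × I, X) := ⟨Gfun, hGc⟩
      have hGapp : ∀ t s, G (t, s) = if (s : ℝ) ≤ τ then G₀ (t, s)
          else K (t, RelativeCompression.affTime τ (τ' - τ) s) := fun _ _ => rfl
      have haff1 : ∀ s : I, τ' ≤ (s : ℝ) → RelativeCompression.affTime τ (τ' - τ) s = 1 := fun s hs =>
        RelativeCompression.affTime_eq_one τ (τ' - τ) hττ' s (by linarith)
      have hone : τ' ≤ ((1 : I) : ℝ) := by rw [hτ']; simp only [Set.Icc.coe_one]; linarith
      have hG1 : ∀ t, G (t, 1) = K (t, 1) := fun t => by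
        rw [hGapp, if_neg (by simp only [Set.Icc.coe_one]; linarith), haff1 1 hone]
      have hg_face : ∀ i w, g (stdFace i w) = S.P (η.face i) (w, 1) := fun i w => by rw [hgapp, hG₀s]
      have hGs : ∀ i w s, G (stdFace i w, s) = S.P (η.face i) (w, s) := fun i w s => by
        rw [hGapp]
        split_ifs with hs
        · rw [hG₀s]
        · rw [hKb _ (stdFace_mem_stdBoundary i w), hg_face, S.stat _ w s (le_of_lt (not_le.1 hs))]
      have hGV : ∀ t s, G (t, s) ∈ Xf j₀ := fun t s => by
        rw [hGapp]
        split_ifs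
        · exact hG₀V t s
        · exact hKV _ _
      refine ⟨G, fun t => ?_, hGs, fun t s hs => ?_, fun z => ?_, fun h => absurd h hη,
        fun j hj z s => hmono (minIdx_le hcov η hj) (hGV z s)⟩
      · rw [hGapp, if_pos (by simp only [Set.Icc.coe_zero]; exact hτ0.le), hG₀0]
      · have hs' : τ' ≤ (s : ℝ) := by rw [hτ', hτdef, ← tau_succ]; exact hs
        rw [hGapp, if_neg (by linarith), haff1 s hs', hG1]
      · by_cases hz : z ∈ stdBoundary (k + 1)
        · exact hbdry G hGs z hz
        · -- an interior point: `dimPt z = k + 1`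
          have hdim : dimPt z = k + 1 := by
            unfold dimPt
            have : StdSimplexCW.support z = Finset.univ := by
              refine Finset.eq_univ_of_forall fun l => StdSimplexCW.mem_support_iff.2 fun hl => hz ⟨l, hl⟩
            rw [this, Finset.card_univ, Fintype.card_fin]; rfl
          rw [hdim, hG1]
          exact hK1 z
  choose G hG0 hGs hGst hGe hGc hGfp using key
  exact ⟨{ P := G, bot := hG0, stat := hGst, endCell := hGe, cell := hGc, fp := hGfp,
           compat := EilenbergRetraction.compatible_faces_succ G S.P hGs }, hGs⟩

/-! ### The tower of stages -/

/-- **All the stages at once**, each extending the previous one on the faces, from the oracle in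
every dimension (by dependent choice). [cite: Spanier1981, Ch. 9 Sec. 2 Lemma 3] -/
theorem exists_tower (hmono : Monotone Xf) (hcov : Covers Xf) (hor : ∀ n, Oracle Xf n) :
    ∃ st : (k : ℕ) → FStage Xf k, ∀ (k : ℕ) (η : SingularSimplex X (k + 1)) (i : Fin (k + 2))
      (t : StdSimplex k) (s : I), (st (k + 1)).P η (stdFace i t, s) = (st k).P (η.face i) (t, s) := by
  classical
  let S0 : FStage Xf 0 := Classical.choice (exists_stage_zero hmono hcov (hor 0))
  let nxt : (k : ℕ) → FStage Xf k → FStage Xf (k + 1) := fun k S =>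
    Classical.choose (exists_stage_succ S hmono hcov (hor (k + 1)))
  have hnxt : ∀ k (S : FStage Xf k) η i t s, (nxt k S).P η (stdFace i t, s) = S.P (η.face i) (t, s) :=
    fun k S => Classical.choose_spec (exists_stage_succ S hmono hcov (hor (k + 1)))
  let st : (k : ℕ) → FStage Xf k := fun k => Nat.rec (motive := fun k => FStage Xf k) S0 (fun k S => nxt k S) k
  exact ⟨st, fun k => hnxt k (st k)⟩


/-! ### The cellular subcomplex and the deformation operator -/

section Chains

variable (Xf) (R : Type uR) [CommRing R]

/-- The cellular singular simplices of degree `q`. [folklore] -/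
def cellSimplices (q : ℕ) : Set (SingularSimplex X q) := {ρ | IsCellular Xf ρ}

/-- The cellular chains of degree `q`: chains supported on cellular simplices. [folklore] -/
def cellChains (q : ℕ) : Submodule R (CChain R X q) := Finsupp.supported R R (cellSimplices Xf q)

variable {Xf R}

/-- Membership in the cellular chains: every simplex of the chain is cellular. [folklore] -/
theorem mem_cellChains_iff {q : ℕ} (c : CChain R X q) :
    c ∈ cellChains Xf R q ↔ ∀ ρ ∈ c.support, IsCellular Xf ρ := by
  rw [cellChains, Finsupp.mem_supported']
  constructor
  · intro h ρ hρ
    by_contra hρ'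
    exact (Finsupp.mem_support_iff.1 hρ) (h ρ hρ')
  · intro h ρ hρ
    by_contra hρ'
    exact hρ (h ρ (Finsupp.mem_support_iff.2 hρ'))

/-- Elementary chains on cellular simplices are cellular chains. [folklore] -/
theorem single_mem_cellChains {q : ℕ} {ρ : SingularSimplex X q} (hρ : IsCellular Xf ρ) (r : R) :
    Finsupp.single ρ r ∈ cellChains Xf R q :=
  Finsupp.single_mem_supported R r hρ

/-- The boundary of a cellular chain is cellular. [folklore] -/
theorem bd_mem_cellChains {q : ℕ} {c : CChain R X (q + 1)} (hc : c ∈ cellChains Xf R (q + 1)) :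
    csingularChainComplex.bd R q c ∈ cellChains Xf R q := by
  rw [← Finsupp.sum_single c, Finsupp.sum, map_sum]
  refine Submodule.sum_mem _ fun ρ hρ => ?_
  rw [csingularChainComplex.bd_single]
  refine Submodule.sum_mem _ fun i _ => Submodule.smul_mem _ _ (single_mem_cellChains ?_ _)
  exact ((mem_cellChains_iff c).1 hc ρ hρ).face i

variable (Xf R)

/-- **The cellular singular chain complex `Δ̄(X)`** of the filtered space, as a subcomplex of the
concrete singular chain complex (Spanier 1981, Ch. 9 Sec. 2, before Lemma 3: "the subcomplex of
`Δ(X)` generated by the cellular singular simplices"). [cite: Spanier1981, Ch. 9 Sec. 2 Lemma 3] -/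
def cellSub : Subcomplex (csingularChainComplex R R X) where
  carrier q := cellChains Xf R q
  d_mem' hx := d_mem_of_bd_mem R R (fun q => cellChains Xf R q) (fun _ _ hc => bd_mem_cellChains hc) hx

/-- `cellSub` in a degree is `cellChains`. [folklore] -/
theorem cellSub_apply (q : ℕ) : cellSub Xf R q = cellChains Xf R q := rfl

variable {Xf}
variable (st : (k : ℕ) → FStage Xf k)
  (hst : ∀ (k : ℕ) (η : SingularSimplex X (k + 1)) (i : Fin (k + 2)) (t : StdSimplex k) (s : I),
    (st (k + 1)).P η (stdFace i t, s) = (st k).P (η.face i) (t, s))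

/-- The stages as `StageData` for the subspace `univ` (to run the tree's chain-level pipeline
`StagedDeformation.*`). [folklore] -/
def toStageData (k : ℕ) : StageData (univ : Set X) k where
  P := (st k).P
  bot := (st k).bot
  stat := (st k).stat
  endA _ _ := mem_univ _
  inA _ _ _ _ := mem_univ _
  compat := (st k).compat

/-- The stage family up to `m`. [folklore] -/
def stg (m : ℕ) : (k : ℕ) → k ≤ m → StageData (univ : Set X) k := fun k _ => toStageData st k

include hst in
/-- The stage family is compatible on the faces. [folklore] -/
theorem stg_compat (m : ℕ) : ∀ (k : ℕ) (hk : k + 1 ≤ m) (η : SingularSimplex X (k + 1)) (i : Fin (k + 2))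
    (t : StdSimplex k) (s : I),
    (stg st m (k + 1) hk).P η (stdFace i t, s) = (stg st m k (Nat.le_of_succ_le hk)).P (η.face i) (t, s) :=
  fun k _ => hst k

/-- The deformed (cellular) simplex `ρ̄ = P ρ (·, 1)`. [folklore] -/
def endS (k : ℕ) (ρ : SingularSimplex X k) : SingularSimplex X k :=
  ofMap (((st k).P ρ).comp ⟨fun z => (z, 1), continuous_id.prodMk continuous_const⟩)

/-- Pointwise formula for the deformed simplex. [folklore] -/
theorem endS_apply (k : ℕ) (ρ : SingularSimplex X k) (z : StdSimplex k) :
    toContinuousMap (endS st k ρ) z = (st k).P ρ (z, 1) := by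
  rw [endS, toContinuousMap_ofMap]; rfl

/-- The tree's `endSimplex` of the wrapped family is `endS`. [folklore] -/
theorem endSimplex_eq (m k : ℕ) (hk : k ≤ m) (ρ : SingularSimplex X k) :
    StagedDeformation.endSimplex (stg st m) hk ρ = endS st k ρ := rfl

/-- The deformed simplex is cellular. [folklore] -/
theorem isCellular_endS (k : ℕ) (ρ : SingularSimplex X k) : IsCellular Xf (endS st k ρ) := fun z => by
  rw [endS_apply]; exact (st k).endCell ρ z

/-- A cellular simplex is not deformed. [folklore] -/
theorem endS_of_isCellular (k : ℕ) {ρ : SingularSimplex X k} (hρ : IsCellular Xf ρ) : endS st k ρ = ρ := by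
  apply toContinuousMap.injective
  ext z
  rw [endS_apply]
  exact (st k).cell ρ hρ z 1

include hst in
/-- The faces of the deformed simplex are the deformed faces. [folklore] -/
theorem endS_face (k : ℕ) (η : SingularSimplex X (k + 1)) (i : Fin (k + 2)) :
    (endS st (k + 1) η).face i = endS st k (η.face i) := by
  apply toContinuousMap.injective
  ext t
  rw [toContinuousMap_face_apply, endS_apply, endS_apply]
  exact hst k η i t 1

/-- **The deformation operator `τ : Cₖ(X) → Cₖ(X)`**, `ρ ↦ ρ̄`. [cite: Spanier1981, Ch. 9 Sec. 2 Lemma 3] -/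
def tauOp (k : ℕ) : CChain R X k →ₗ[R] CChain R X k := Finsupp.lmapDomain R R (endS st k)

/-- `τ` on an elementary chain. [folklore] -/
@[simp]
theorem tauOp_single (k : ℕ) (ρ : SingularSimplex X k) (r : R) :
    tauOp R st k (Finsupp.single ρ r) = Finsupp.single (endS st k ρ) r := Finsupp.mapDomain_single

/-- The tree's `endOp` of the wrapped family is `tauOp`. [folklore] -/
theorem endOp_eq (m k : ℕ) (hk : k ≤ m) : StagedDeformation.endOp (stg st m) R hk = tauOp R st k := rfl

/-- `τ` lands in the cellular chains. [folklore] -/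
theorem tauOp_mem (k : ℕ) (c : CChain R X k) : tauOp R st k c ∈ cellChains Xf R k := by
  induction c using Finsupp.induction_linear with
  | zero => rw [map_zero]; exact Submodule.zero_mem _
  | add f g hf hg => rw [map_add]; exact Submodule.add_mem _ hf hg
  | single ρ r => rw [tauOp_single]; exact single_mem_cellChains (isCellular_endS st k ρ) r

/-- `τ` is the identity on cellular chains. [folklore] -/
theorem tauOp_of_mem (k : ℕ) {c : CChain R X k} (hc : c ∈ cellChains Xf R k) : tauOp R st k c = c := by
  rw [← Finsupp.sum_single c, Finsupp.sum, map_sum]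
  refine Finset.sum_congr rfl fun ρ hρ => ?_
  rw [tauOp_single, endS_of_isCellular st k ((mem_cellChains_iff c).1 hc ρ hρ)]

include hst in
/-- `τ` is a chain map: `∂ τ = τ ∂`. [folklore] -/
theorem bd_tauOp (k : ℕ) (c : CChain R X (k + 1)) :
    csingularChainComplex.bd R k (tauOp R st (k + 1) c) = tauOp R st k (csingularChainComplex.bd R k c) := by
  have h : (csingularChainComplex.bd R k) ∘ₗ tauOp R st (k + 1) = tauOp R st k ∘ₗ csingularChainComplex.bd R k := by
    refine Finsupp.lhom_ext fun η r => ?_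
    simp only [LinearMap.comp_apply, tauOp_single, csingularChainComplex.bd_single, map_sum, map_smul,
      endS_face st hst]
  exact LinearMap.congr_fun h c

include hst in
/-- `∂ D c = τ c - c - D ∂ c` in positive degrees (the tree's `StagedDeformation.bd_prismOp_succ`).
[cite: Spanier1981, Ch. 7 Sec. 4 Lemma 7] -/
theorem bd_prismOp_succ (m : ℕ) {k : ℕ} (hk : k + 1 ≤ m) (c : CChain R X (k + 1)) :
    csingularChainComplex.bd R (k + 1) (StagedDeformation.prismOp (stg st m) R hk c) =
      tauOp R st (k + 1) c - c -
        StagedDeformation.prismOp (stg st m) R (Nat.le_of_succ_le hk) (csingularChainComplex.bd R k c) :=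
  StagedDeformation.bd_prismOp_succ (stg st m) (stg_compat st hst m) hk c

/-- `∂ D c = τ c - c` in degree `0`. [folklore] -/
theorem bd_prismOp_zero (m : ℕ) (c : CChain R X 0) :
    csingularChainComplex.bd R 0 (StagedDeformation.prismOp (stg st m) R (Nat.zero_le m) c) = tauOp R st 0 c - c :=
  StagedDeformation.bd_prismOp_zero (stg st m) c

/-! ### `Δ̄(X) ↪ Δ(X)` is a quasi-isomorphism -/

include hst in
/-- **`Hᵢ(Δ̄(X)) → Hᵢ(Δ(X))` is injective**: a cellular cycle bounding in `Δ(X)` bounds in `Δ̄(X)`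
(`z = ∂w ⇒ z = τ z = τ ∂ w = ∂ (τ w)`). [cite: Spanier1981, Ch. 9 Sec. 2 Lemma 3] -/
theorem injective_homologyMap_ι (i : ℕ) :
    Function.Injective (HomologicalComplex.homologyMap (cellSub Xf R).ι i) := by
  rw [homologyMap_injective_iff]
  intro z _ hb
  rw [exists_d_apply_eq_iff_of_eq _ (ChainComplex.prev ℕ i)] at hb ⊢
  obtain ⟨w, hw⟩ := hb
  rw [csingularChainComplex.d_apply, Subcomplex.ι_f_apply] at hw
  refine ⟨⟨tauOp R st (i + 1) w, tauOp_mem R st (i + 1) w⟩, Subtype.ext ?_⟩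
  rw [Subcomplex.toComplex_d_apply_val, csingularChainComplex.d_apply]
  change csingularChainComplex.bd R i (tauOp R st (i + 1) w) = z.1
  rw [bd_tauOp R st hst, hw, tauOp_of_mem R st i z.2]

include hst in
/-- **`Hᵢ(Δ̄(X)) → Hᵢ(Δ(X))` is surjective**: every cycle `z` is homologous to the cellular cycle
`τ z`, by `∂ D z = τ z - z - D ∂ z = τ z - z`. [cite: Spanier1981, Ch. 9 Sec. 2 Lemma 3] -/
theorem surjective_homologyMap_ι (i : ℕ) :
    Function.Surjective (HomologicalComplex.homologyMap (cellSub Xf R).ι i) := by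
  rw [homologyMap_surjective_iff]
  intro z hz
  have hτz : (cellSub Xf R).toComplex.d i ((ComplexShape.down ℕ).next i)
      (⟨tauOp R st i z, tauOp_mem R st i z⟩ : (cellSub Xf R).toComplex.X i) = 0 := by
    apply Subtype.ext
    rw [Subcomplex.toComplex_d_apply_val]
    change (csingularChainComplex R R X).d i _ (tauOp R st i z) = 0
    cases i with
    | zero =>
      rw [(csingularChainComplex R R X).shape 0 _ (by simp [ChainComplex.next_nat_zero])]; rfl
    | succ i =>
      rw [d_apply_eq_zero_iff_of_eq _ (ChainComplex.next_nat_succ i)] at hz ⊢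
      rw [csingularChainComplex.d_apply] at hz ⊢
      rw [bd_tauOp R st hst, hz]
      exact map_zero _
  refine ⟨⟨tauOp R st i z, tauOp_mem R st i z⟩, hτz, ?_⟩
  rw [exists_d_apply_eq_iff_of_eq _ (ChainComplex.prev ℕ i)]
  refine ⟨-StagedDeformation.prismOp (stg st (i + 1)) R (Nat.le_succ i) z, ?_⟩
  rw [csingularChainComplex.d_apply, Subcomplex.ι_f_apply, map_neg]
  cases i with
  | zero =>
    rw [bd_prismOp_zero R st 1]
    exact neg_sub _ _
  | succ i =>
    rw [d_apply_eq_zero_iff_of_eq _ (ChainComplex.next_nat_succ i), csingularChainComplex.d_apply] at hz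
    replace hz : csingularChainComplex.bd R i z = 0 := hz
    rw [bd_prismOp_succ R st hst (i + 1 + 1) (k := i) (Nat.le_succ _), hz, map_zero, sub_zero]
    exact neg_sub _ _

include hst in
/-- **Spanier 9.2 Lemma 3 (absolute, from a tower of stages)**: the inclusion `Δ̄(X) ⊂ Δ(X)` of the
cellular singular chains induces isomorphisms on all homology groups.
[cite: Spanier1981, Ch. 9 Sec. 2 Lemma 3] -/
theorem isIso_homologyMap_ι (i : ℕ) : IsIso (HomologicalComplex.homologyMap (cellSub Xf R).ι i) := by
  haveI : Mono (HomologicalComplex.homologyMap (cellSub Xf R).ι i) :=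
    (ModuleCat.mono_iff_injective _).2 (injective_homologyMap_ι R st hst i)
  haveI : Epi (HomologicalComplex.homologyMap (cellSub Xf R).ι i) :=
    (ModuleCat.epi_iff_surjective _).2 (surjective_homologyMap_ι R st hst i)
  exact isIso_of_mono_of_epi _

end Chains

/-- **Spanier 9.2 Lemma 3 (absolute form)**: for a monotone filtration `Xf` of `X` admitting the
compression oracle in every dimension (e.g. the skeleta of a CW complex, `oracle_of_cwComplex`),
the inclusion `Δ̄(X) ⊂ Δ(X)` of the cellular singular chain complex induces isomorphisms on all
homology groups ("`Δ̄(X)` is a chain deformation retract of `Δ(X)`").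
[cite: Spanier1981, Ch. 9 Sec. 2 Lemma 3] -/
theorem isIso_homologyMap_cellSub_ι (hmono : Monotone Xf) (hcov : Covers Xf) (hor : ∀ n, Oracle Xf n)
    (R : Type uR) [CommRing R] (i : ℕ) : IsIso (HomologicalComplex.homologyMap (cellSub Xf R).ι i) := by
  obtain ⟨st, hst⟩ := exists_tower hmono hcov hor
  exact isIso_homologyMap_ι R st hst i


/-! ### Inside a term of the filtration: `Δ̄(X) ∩ Δ(Xf j) ↪ Δ(Xf j)` is a quasi-isomorphism -/

section InSubspace

variable (Xf) (R : Type uR) [CommRing R]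
variable {Xf}
variable (st : (k : ℕ) → FStage Xf k)
  (hst : ∀ (k : ℕ) (η : SingularSimplex X (k + 1)) (i : Fin (k + 2)) (t : StdSimplex k) (s : I),
    (st (k + 1)).P η (stdFace i t, s) = (st k).P (η.face i) (t, s))
variable (j : ℕ)

/-- `τ` preserves the chains of `Xf j`. [folklore] -/
theorem tauOp_mem_chainsIn (k : ℕ) {c : CChain R X k} (hc : c ∈ chainsIn R R X (Xf j) k) :
    tauOp R st k c ∈ chainsIn R R X (Xf j) k := by
  rw [mem_chainsIn_iff] at hc
  rw [← Finsupp.sum_single c, Finsupp.sum, map_sum]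
  refine Submodule.sum_mem _ fun ρ hρ => ?_
  rw [tauOp_single]
  refine single_mem_chainsIn R R (fun x ⟨z, hz⟩ => ?_) _
  rw [← hz, endS_apply]
  exact (st k).fp ρ j (hc ρ hρ) z 1

/-- `D` preserves the chains of `Xf j`. [folklore] -/
theorem prismOp_mem_chainsIn (m : ℕ) {k : ℕ} (hk : k ≤ m) {c : CChain R X k} (hc : c ∈ chainsIn R R X (Xf j) k) :
    StagedDeformation.prismOp (stg st m) R hk c ∈ chainsIn R R X (Xf j) (k + 1) := by
  rw [mem_chainsIn_iff] at hc
  rw [← Finsupp.sum_single c, Finsupp.sum, map_sum]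
  refine Submodule.sum_mem _ fun ρ hρ => ?_
  rw [StagedDeformation.prismOp_single]
  refine Submodule.smul_mem _ _ (chainPush_mem_chainsIn _ (fun p => ?_) _)
  rw [StagedDeformation.cylOf_apply]
  exact (st k).fp ρ j (hc ρ hρ) p.down.1 p.down.2

/-- The cellular chains inside `Δ(Xf j)`, as a subcomplex of `Δ(Xf j)`. [folklore] -/
abbrev cellSubIn : Subcomplex (chainsInSub R R X (Xf j)).toComplex := (cellSub Xf R).comap (chainsInSub R R X (Xf j)).ι

include hst in
/-- Injectivity on homology of `Δ̄(X) ∩ Δ(Xf j) ↪ Δ(Xf j)`. [cite: Spanier1981, Ch. 9 Sec. 2 Lemma 3] -/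
theorem injective_homologyMap_cellSubIn_ι (i : ℕ) :
    Function.Injective (HomologicalComplex.homologyMap (cellSubIn (Xf := Xf) R j).ι i) := by
  rw [homologyMap_injective_iff]
  intro z _ hb
  rw [exists_d_apply_eq_iff_of_eq _ (ChainComplex.prev ℕ i)] at hb ⊢
  obtain ⟨w, hw⟩ := hb
  rw [Subcomplex.ι_f_apply] at hw
  have hw' := congrArg Subtype.val hw
  rw [Subcomplex.toComplex_d_apply_val, csingularChainComplex.d_apply] at hw'
  -- `τ w` is a cellular chain of `Xf j` with `∂ (τ w) = z`
  refine ⟨⟨⟨tauOp R st (i + 1) w.1, tauOp_mem_chainsIn R st j (i + 1) w.2⟩,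
    show tauOp R st (i + 1) w.1 ∈ cellChains Xf R (i + 1) from tauOp_mem R st (i + 1) w.1⟩, Subtype.ext (Subtype.ext ?_)⟩
  rw [Subcomplex.toComplex_d_apply_val, Subcomplex.toComplex_d_apply_val, csingularChainComplex.d_apply]
  change csingularChainComplex.bd R i (tauOp R st (i + 1) w.1) = z.1.1
  have hz2 : (z.1.1 : CChain R X i) ∈ cellChains Xf R i := z.2
  rw [bd_tauOp R st hst, hw', tauOp_of_mem R st i hz2]

include hst in
/-- Surjectivity on homology of `Δ̄(X) ∩ Δ(Xf j) ↪ Δ(Xf j)`. [cite: Spanier1981, Ch. 9 Sec. 2 Lemma 3] -/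
theorem surjective_homologyMap_cellSubIn_ι (i : ℕ) :
    Function.Surjective (HomologicalComplex.homologyMap (cellSubIn (Xf := Xf) R j).ι i) := by
  rw [homologyMap_surjective_iff]
  intro z hz
  let S := chainsInSub R R X (Xf j)
  -- the cellular cycle `τ z` of `Δ(Xf j)`
  let tz : S.toComplex.X i := ⟨tauOp R st i z.1, tauOp_mem_chainsIn R st j i z.2⟩
  have htzmem : tz ∈ cellSubIn (Xf := Xf) R j i := show tauOp R st i z.1 ∈ cellChains Xf R i from tauOp_mem R st i z.1
  have hτz : (cellSubIn (Xf := Xf) R j).toComplex.d i ((ComplexShape.down ℕ).next i)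
      (⟨tz, htzmem⟩ : (cellSubIn (Xf := Xf) R j).toComplex.X i) = 0 := by
    apply Subtype.ext; apply Subtype.ext
    rw [Subcomplex.toComplex_d_apply_val, Subcomplex.toComplex_d_apply_val]
    change (csingularChainComplex R R X).d i _ (tauOp R st i z.1) = 0
    cases i with
    | zero =>
      rw [(csingularChainComplex R R X).shape 0 _ (by simp [ChainComplex.next_nat_zero])]; rfl
    | succ i =>
      rw [d_apply_eq_zero_iff_of_eq _ (ChainComplex.next_nat_succ i)] at hz ⊢
      have hz' := congrArg Subtype.val hz
      rw [Subcomplex.toComplex_d_apply_val, csingularChainComplex.d_apply] at hz'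
      rw [csingularChainComplex.d_apply, bd_tauOp R st hst]
      change tauOp R st i (csingularChainComplex.bd R i z.1) = 0
      rw [show csingularChainComplex.bd R i z.1 = 0 from hz', map_zero]
  refine ⟨⟨tz, htzmem⟩, hτz, ?_⟩
  rw [exists_d_apply_eq_iff_of_eq _ (ChainComplex.prev ℕ i)]
  refine ⟨⟨-StagedDeformation.prismOp (stg st (i + 1)) R (Nat.le_succ i) z.1,
    Submodule.neg_mem _ (prismOp_mem_chainsIn R st j (i + 1) (Nat.le_succ i) z.2)⟩, Subtype.ext ?_⟩
  rw [Subcomplex.toComplex_d_apply_val, csingularChainComplex.d_apply, Subcomplex.ι_f_apply]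
  change csingularChainComplex.bd R i (-StagedDeformation.prismOp (stg st (i + 1)) R (Nat.le_succ i) z.1) =
    (show CChain R X i from z.1) - tauOp R st i z.1
  rw [map_neg]
  cases i with
  | zero =>
    rw [bd_prismOp_zero R st 1]
    exact neg_sub _ _
  | succ i =>
    rw [d_apply_eq_zero_iff_of_eq _ (ChainComplex.next_nat_succ i)] at hz
    have hz' := congrArg Subtype.val hz
    rw [Subcomplex.toComplex_d_apply_val, csingularChainComplex.d_apply] at hz'
    replace hz' : csingularChainComplex.bd R i z.1 = 0 := hz'
    rw [bd_prismOp_succ R st hst (i + 1 + 1) (k := i) (Nat.le_succ _), hz', map_zero, sub_zero]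
    exact neg_sub _ _

include hst in
/-- **Spanier 9.2 Lemma 3 inside a term of the filtration (from a tower)**: the inclusion
`Δ̄(X) ∩ Δ(Xf j) ↪ Δ(Xf j)` induces isomorphisms on all homology groups.
[cite: Spanier1981, Ch. 9 Sec. 2 Lemma 3] -/
theorem isIso_homologyMap_cellSubIn_ι_of_tower (i : ℕ) :
    IsIso (HomologicalComplex.homologyMap (cellSubIn (Xf := Xf) R j).ι i) := by
  haveI : Mono (HomologicalComplex.homologyMap (cellSubIn (Xf := Xf) R j).ι i) :=
    (ModuleCat.mono_iff_injective _).2 (injective_homologyMap_cellSubIn_ι R st hst j i)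
  haveI : Epi (HomologicalComplex.homologyMap (cellSubIn (Xf := Xf) R j).ι i) :=
    (ModuleCat.epi_iff_surjective _).2 (surjective_homologyMap_cellSubIn_ι R st hst j i)
  exact isIso_of_mono_of_epi _

end InSubspace

/-- **Spanier 9.2 Lemma 3 inside a term of the filtration**: under the hypotheses of
`isIso_homologyMap_cellSub_ι`, for every `j` the inclusion `Δ̄(X) ∩ Δ(Xf j) ↪ Δ(Xf j)` of the
cellular chains of `Xf j` into all singular chains of `Xf j` induces isomorphisms on homology
(Spanier: "`Δ̄(X') = Δ̄(X) ∩ Δ(X')` is a chain deformation retract of `Δ(X')`" for subspaces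
compatible with the filtration). [cite: Spanier1981, Ch. 9 Sec. 2 Lemma 3] -/
theorem isIso_homologyMap_cellSubIn_ι (hmono : Monotone Xf) (hcov : Covers Xf) (hor : ∀ n, Oracle Xf n)
    (R : Type uR) [CommRing R] (j i : ℕ) : IsIso (HomologicalComplex.homologyMap (cellSubIn (Xf := Xf) R j).ι i) := by
  obtain ⟨st, hst⟩ := exists_tower hmono hcov hor
  exact isIso_homologyMap_cellSubIn_ι_of_tower R st hst j i

/-! ### The skeleta of a CW complex admit the oracle (cellular approximation) -/

section CW

variable (Y : Type u) [TopologicalSpace Y] [T2Space Y] [CWComplex (univ : Set Y)]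

/-- The skeletal filtration `k ↦ Yᵏ` of a CW complex (`Yᵏ = skeletonLT (k+1)`). [folklore] -/
def skel (k : ℕ) : Set Y := (RelCWComplex.skeletonLT (univ : Set Y) ((k + 1 : ℕ) : ℕ∞) : Set Y)

/-- The skeleta increase. [folklore] -/
theorem monotone_skel : Monotone (skel Y) := fun a b h =>
  RelCWComplex.skeletonLT_mono (by exact_mod_cast Nat.succ_le_succ h)

/-- The tree's downward induction `exists_homotopy_into_skeleton_of_mapsTo` with its range
clause kept: a cube map into `skeletonLT (n+d+1)` is pushed into `skeletonLT (n+1)` INSIDE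
`skeletonLT (n+d+1)`. [cite: HatcherAT2002, Thm. 4.8 (proof, p. 349)] -/
theorem exists_homotopy_into_skeleton_of_mapsTo' (n d : ℕ) :
    ∀ c : (Fin n → ℝ) → Y, ContinuousOn c (Metric.closedBall 0 1) →
      MapsTo c (Metric.closedBall 0 1) (RelCWComplex.skeletonLT (univ : Set Y) (n + d + 1 : ℕ) : Set Y) →
      ∃ Γ : (Fin n → ℝ) × ℝ → Y,
        ContinuousOn Γ (Metric.closedBall (0 : Fin n → ℝ) 1 ×ˢ Icc (0 : ℝ) 1) ∧
        (∀ w ∈ Metric.closedBall (0 : Fin n → ℝ) 1, Γ (w, 0) = c w) ∧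
        (∀ w ∈ Metric.closedBall (0 : Fin n → ℝ) 1,
          c w ∈ (RelCWComplex.skeletonLT (univ : Set Y) (n + 1 : ℕ) : Set Y) → ∀ t, Γ (w, t) = c w) ∧
        (∀ w ∈ Metric.closedBall (0 : Fin n → ℝ) 1, ∀ t ∈ Icc (0 : ℝ) 1,
          Γ (w, t) ∈ (RelCWComplex.skeletonLT (univ : Set Y) (n + d + 1 : ℕ) : Set Y)) ∧
        (∀ w ∈ Metric.closedBall (0 : Fin n → ℝ) 1,
          Γ (w, 1) ∈ (RelCWComplex.skeletonLT (univ : Set Y) (n + 1 : ℕ) : Set Y)) := by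
  induction d with
  | zero =>
    intro c hc hcY
    exact ⟨fun p => c p.1, hc.comp continuousOn_fst fun p hp => hp.1, fun w _ => rfl, fun w _ _ t => rfl,
      fun w hw t _ => by simpa using hcY hw, fun w hw => by simpa using hcY hw⟩
  | succ d ih =>
    intro c hc hcY
    have heq : n + (d + 1) + 1 = n + d + 1 + 1 := by omega
    rw [heq] at hcY
    obtain ⟨Γ₁, hΓ₁c, hΓ₁0, hΓ₁stat, hΓ₁val, hΓ₁end⟩ := exists_homotopy_clear_dim (Nat.le_add_right n d) c hc hcY
    set c' : (Fin n → ℝ) → Y := fun w => Γ₁ (w, 1) with hc'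
    have hc'c : ContinuousOn c' (Metric.closedBall 0 1) :=
      hΓ₁c.comp (by fun_prop : Continuous fun w : Fin n → ℝ => (w, (1 : ℝ))).continuousOn
        fun w hw => ⟨hw, ⟨zero_le_one, le_rfl⟩⟩
    obtain ⟨Γ₂, hΓ₂c, hΓ₂0, hΓ₂stat, hΓ₂val, hΓ₂end⟩ := ih c' hc'c fun w hw => hΓ₁end w hw
    have hmono : (RelCWComplex.skeletonLT (univ : Set Y) (n + 1 : ℕ) : Set Y) ⊆
        (RelCWComplex.skeletonLT (univ : Set Y) (n + d + 1 : ℕ) : Set Y) :=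
      RelCWComplex.skeletonLT_mono (by exact_mod_cast (by omega : n + 1 ≤ n + d + 1))
    have hmono' : (RelCWComplex.skeletonLT (univ : Set Y) (n + d + 1 : ℕ) : Set Y) ⊆
        (RelCWComplex.skeletonLT (univ : Set Y) (n + (d + 1) + 1 : ℕ) : Set Y) :=
      RelCWComplex.skeletonLT_mono (by exact_mod_cast (by omega : n + d + 1 ≤ n + (d + 1) + 1))
    refine ⟨concatHtpy Γ₁ Γ₂, continuousOn_concatHtpy hΓ₁c hΓ₂c fun w hw => (hΓ₂0 w hw).symm,
      fun w hw => ?_, fun w hw hws t => ?_, fun w hw t ht => ?_, fun w hw => ?_⟩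
    · rw [concatHtpy_zero]; exact hΓ₁0 w hw
    · have h1 : ∀ t, Γ₁ (w, t) = c w := hΓ₁stat w hw (hmono hws)
      have h2 : c' w = c w := h1 1
      exact concatHtpy_eq_of_forall Γ₁ Γ₂ h1 (fun t => by rw [hΓ₂stat w hw (by rw [h2]; exact hws), h2]) t
    · refine concatHtpy_mem Γ₁ Γ₂ (fun s hs => ?_) (fun s hs => hmono' (hΓ₂val w hw s hs)) ht
      rw [heq]; exact hΓ₁val w hw s hs
    · rw [concatHtpy_one]; exact hΓ₂end w hw

omit [T2Space Y] in
/-- Every singular simplex of a CW complex lies in a finite skeleton. [cite: HatcherAT2002, Prop. A.1 (p. 520)] -/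
theorem covers_skel [T2Space Y] : Covers (skel Y) := fun k ρ => by
  obtain ⟨D, hD⟩ := exists_subset_skeletonLT_of_isCompact (Y := Y) (isCompact_range ρ)
  exact ⟨D, hD.trans (RelCWComplex.skeletonLT_mono (by exact_mod_cast Nat.le_succ D))⟩

/-- **The skeleta of a CW complex admit the compression oracle in every dimension**: a singular
simplex `Δⁿ → Yʲ` with boundary in `Yⁿ` deforms rel boundary into `Yⁿ`, inside `Yʲ` (the tree's
cellular approximation `exists_homotopy_clear_dim`, iterated with its range clause, transported
along the radial homeomorphism `Δⁿ ≅ 𝔻ⁿ` of `SimplexBallHomeomorph.lean`).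
[cite: Spanier1981, Ch. 9 Sec. 2 Lemma 3 (hypothesis, from Ch. 7 Sec. 6 Cor. 18)] -/
theorem oracle_skel (n : ℕ) : Oracle (skel Y) n := by
  intro g j hgj hg
  -- the simplex map as a cube map
  let c : (Fin n → ℝ) → Y := fun w =>
    g ((SimplexBall.toBall n).symm ⟨(max 1 ‖w‖)⁻¹ • w, IsFibreBundleWith.ballProj_mem w⟩)
  have hc : Continuous c := g.continuous.comp ((SimplexBall.toBall n).symm.continuous.comp
    (IsFibreBundleWith.continuous_ballProj.subtype_mk _))
  have hcball : ∀ t : StdSimplex n, c (SimplexBall.toBall n t) = g t := fun t => by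
    show g ((SimplexBall.toBall n).symm ⟨(max 1 ‖((SimplexBall.toBall n t : Metric.closedBall (0 : Fin n → ℝ) 1) :
      Fin n → ℝ)‖)⁻¹ • _, _⟩) = g t
    have : (⟨(max 1 ‖((SimplexBall.toBall n t : Metric.closedBall (0 : Fin n → ℝ) 1) : Fin n → ℝ)‖)⁻¹ •
        ((SimplexBall.toBall n t : Metric.closedBall (0 : Fin n → ℝ) 1) : Fin n → ℝ), IsFibreBundleWith.ballProj_mem _⟩ :
        Metric.closedBall (0 : Fin n → ℝ) 1) = SimplexBall.toBall n t :=
      Subtype.ext (IsFibreBundleWith.ballProj_of_mem (SimplexBall.toBall n t).2)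
    rw [this, Homeomorph.symm_apply_apply]
  have hcsurj : ∀ w, ∃ t, c w = g t := fun w => ⟨_, rfl⟩
  -- push inside `Yʲ` when `n ≤ j`; for `j < n` the map is already in `Yⁿ` and nothing moves
  obtain ⟨Γ, hΓc, hΓ0, hΓrel, hΓval, hΓ1⟩ : ∃ Γ : (Fin n → ℝ) × ℝ → Y,
      ContinuousOn Γ (Metric.closedBall (0 : Fin n → ℝ) 1 ×ˢ Icc (0 : ℝ) 1) ∧
      (∀ w ∈ Metric.closedBall (0 : Fin n → ℝ) 1, Γ (w, 0) = c w) ∧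
      (∀ w ∈ Metric.closedBall (0 : Fin n → ℝ) 1, c w ∈ skel Y n → ∀ t, Γ (w, t) = c w) ∧
      (∀ w ∈ Metric.closedBall (0 : Fin n → ℝ) 1, ∀ t ∈ Icc (0 : ℝ) 1, Γ (w, t) ∈ skel Y j) ∧
      (∀ w ∈ Metric.closedBall (0 : Fin n → ℝ) 1, Γ (w, 1) ∈ skel Y n) := by
    by_cases hnj : n ≤ j
    · obtain ⟨d, rfl⟩ := Nat.exists_eq_add_of_le hnj
      exact exists_homotopy_into_skeleton_of_mapsTo' Y n d c hc.continuousOn fun w _ => by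
        obtain ⟨t, ht⟩ := hcsurj w; rw [ht]; exact hgj t
    · have hjn : skel Y j ⊆ skel Y n := monotone_skel Y (le_of_lt (not_le.1 hnj))
      refine ⟨fun p => c p.1, hc.continuousOn.comp continuousOn_fst fun p hp => hp.1, fun w _ => rfl,
        fun w _ _ t => rfl, fun w _ t _ => ?_, fun w _ => ?_⟩
      · obtain ⟨t, ht⟩ := hcsurj w; show c w ∈ _; rw [ht]; exact hgj t
      · obtain ⟨t, ht⟩ := hcsurj w; show c w ∈ _; rw [ht]; exact hjn (hgj t)
  have hmem : ∀ p : StdSimplex n × I, (((SimplexBall.toBall n p.1 : Metric.closedBall (0 : Fin n → ℝ) 1) : Fin n → ℝ),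
      (p.2 : ℝ)) ∈ Metric.closedBall (0 : Fin n → ℝ) 1 ×ˢ Icc (0 : ℝ) 1 := fun p =>
    ⟨(SimplexBall.toBall n p.1).2, p.2.2⟩
  let K : C(StdSimplex n × I, Y) :=
    ⟨fun p => Γ (((SimplexBall.toBall n p.1 : Metric.closedBall (0 : Fin n → ℝ) 1) : Fin n → ℝ), (p.2 : ℝ)),
      hΓc.comp_continuous ((continuous_subtype_val.comp ((SimplexBall.toBall n).continuous.comp continuous_fst)).prodMk
        (continuous_subtype_val.comp continuous_snd)) hmem⟩
  refine ⟨K, fun t => ?_, fun t => ?_, fun t ht s => ?_, fun t s => ?_⟩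
  · show Γ (_, ((0 : I) : ℝ)) = g t
    rw [show ((0 : I) : ℝ) = 0 from rfl, hΓ0 _ (SimplexBall.toBall n t).2, hcball]
  · show Γ (_, ((1 : I) : ℝ)) ∈ skel Y n
    exact hΓ1 _ (SimplexBall.toBall n t).2
  · show Γ (_, (s : ℝ)) = g t
    rw [hΓrel _ (SimplexBall.toBall n t).2 (by rw [hcball]; exact hg t ht), hcball]
  · show Γ (_, (s : ℝ)) ∈ skel Y j
    exact hΓval _ (SimplexBall.toBall n t).2 _ s.2

/-- **Spanier 9.2 Lemma 3 for the skeletal filtration of a CW complex**: the inclusion of the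
cellular singular chains `Δ̄(Y) ⊂ Δ(Y)` induces isomorphisms on all homology groups.
[cite: Spanier1981, Ch. 9 Sec. 2 Lemma 3] -/
theorem isIso_homologyMap_cellSub_skel_ι (R : Type uR) [CommRing R] (i : ℕ) :
    IsIso (HomologicalComplex.homologyMap (cellSub (skel Y) R).ι i) :=
  isIso_homologyMap_cellSub_ι (monotone_skel Y) (covers_skel Y) (oracle_skel Y) R i

/-- **Spanier 9.2 Lemma 3 for a subcomplex `Yʲ`**: the inclusion `Δ̄(Y) ∩ Δ(Yʲ) ↪ Δ(Yʲ)` induces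
isomorphisms on all homology groups. [cite: Spanier1981, Ch. 9 Sec. 2 Lemma 3] -/
theorem isIso_homologyMap_cellSubIn_skel_ι (R : Type uR) [CommRing R] (j i : ℕ) :
    IsIso (HomologicalComplex.homologyMap (cellSubIn (Xf := skel Y) R j).ι i) :=
  isIso_homologyMap_cellSubIn_ι (monotone_skel Y) (covers_skel Y) (oracle_skel Y) R j i

end CW

end CellularChains

end Literature.AlgebraicTopology.SingularHomology
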